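import Summits.CriticalPhenomena.SAWScalingLimit.Theorems.SAWReversalUpgradePathUpgradeRInst
import Summits.CriticalPhenomena.SAWScalingLimit.Theorems.SAWReversalUpgradePathUpgradeRSLEGood
import Summits.CriticalPhenomena.SAWScalingLimit.Theorems.SAWReversalUpgradePathUpgradeRAsmRadii
import Summits.CriticalPhenomena.SAWScalingLimit.Theorems.SAWReversalUpgradePathUpgradeRAsmCoarse
import Summits.CriticalPhenomena.SAWScalingLimit.Theorems.SAWReversalUpgradePathUpgradeRAsmFine
import Summits.CriticalPhenomena.SAWScalingLimit.Theorems.SAWReversalUpgradePathUpgradeRAsmEps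
import Summits.CriticalPhenomena.SAWScalingLimit.Theorems.SAWReversalUpgradePathUpgradeRAsmMarginsF
import Summits.CriticalPhenomena.SAWScalingLimit.Theorems.SAWReversalUpgradePathUpgradeRAsmMarginsB
import Summits.CriticalPhenomena.SAWScalingLimit.Theorems.SAWReversalUpgradePathUpgradeRLawClosed
import Summits.CriticalPhenomena.SAWScalingLimit.Theorems.SAWReversalUpgradePathUpgradeRRangeBoundAux
import Literature.Probability.RandomPlanarGeometry.DrivingFunctionMeasurable
import Literature.Probability.RandomPlanarGeometry.ChordalReversibility
import Mathlib.MeasureTheory.Constructions.BorelSpace.Metric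
import HarnessLib

/-!
# `PathUpgradeR`, line `bidir_windows`: the lead's stub `stub_returnsDie` — RETURNS DIE
(crux stmt-CriticalPhenomena-18055, route `SAWReversalUpgrade`)

**Theorem (`stub_returnsDie`, registered stub of `Cruxes/PathUpgradeR/Lines/bidir_windows.lean`).** Under
H1–H7 of the crux (eventually-probability laws, measurable classes, simple lattice curves from `a` to `b`
in `D`, forward AND backward driving functions converging in law on every `[0, T]` to `√(8/3) B`, and the
two no-return windows at `a` and `b`), for every `ℓ > 0` and `η > 0` there is `κ > 0` with, eventually
along the mesh, `P δ {∃ s < u < t, ℓ ≤ |X s - X u|, |X s - X t| ≤ κ} ≤ η`.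

**Proof (assembly).** Constants: `phase1_radii` (H6/H7 radii, SLE no-escape / no-return / tail / start
quantiles, capacity horizons of `stub_latticeDictionary`), `phase2a_coarse` and `phase2b_fine` (moduli of
the SLE reference: interior distance, continuity, injectivity, porosity, conformal height, Brownian
oscillation; the gate of `stub_gate`), `phase3_eps` (the fine constants `ε, ε'` and the shadow moduli;
all numeric relations of `PathUpgradeRInst.inst`). Let `A₀` (`A₀'`) be the set of restricted drivers
`W'|[0,T+2]` (`[0,T'+2]`) admitting NO good forward (backward) reference. Lattice side: on the event of an
`(ℓ, ε)`-return off the seven window events, if both drivers are honest (describable curve classes) and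
off `A₀`, `A₀'`, the good references exist and `PathUpgradeRInst.inst` forbids the return; so the return
event lies in `Y⁻¹(closure A₀) ∪ Y⁻¹{0} ∪ Y'⁻¹(closure A₀') ∪ Y'⁻¹{0} ∪ windows`. Portmanteau
(`stub_lawClosed`, H4 at `T+2`, H5 at `T'+2`) moves the four driver events to the SLE side, where `{0}`
is not charged (`measure_sleDriving_apply_eq_zero`) and `closure A₀` is charged only through the
irregular samples (`PathUpgradeRSLEGood.measure_closure_badDrivers_le` with the margins of
`phase4_marginsF` / `phase4_marginsB`), whose probability the quantile choices bound. Union bound: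
`34 β ≤ 64 β ≤ η`. [folklore]
-/

noncomputable section

open scoped ENNReal NNReal Topology unitInterval
open MeasureTheory Filter Set Metric TopologicalSpace
open Literature.Probability Literature.Probability.RandomPlanarGeometry
open UpperHalfPlane (upperHalfPlaneSet)

namespace Summit.CriticalPhenomena.SAWScalingLimit.Theorems

open PathUpgradeRAsm PathUpgradeRRangeBound in
open scoped PathBorel in
/-- **RETURNS DIE** (`stub_returnsDie`, crux `PathUpgradeR`, line `bidir_windows`). See the module
docstring. [folklore] -/
theorem stub_returnsDie : ∀ (D : Literature.Probability.RandomPlanarGeometry.DobrushinDomain) (φ : Literature.Probability.RandomPlanarGeometry.ConformalEquiv UpperHalfPlane.upperHalfPlaneSet D.carrier), D.IsChordalUniformizing φ → ∀ (φ' : Literature.Probability.RandomPlanarGeometry.ConformalEquiv UpperHalfPlane.upperHalfPlaneSet D.swap.carrier), D.swap.IsChordalUniformizing φ' → ∀ (Ω : ℝ → Type) [∀ δ, MeasurableSpace (Ω δ)] (X : (δ : ℝ) → Ω δ → Literature.Probability.RandomPlanarGeometry.Curve ℂ) (P : (δ : ℝ) → MeasureTheory.Measure (Ω δ)), (∀ᶠ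 δ in (nhdsWithin (0:ℝ) (Set.Ioi 0)), MeasureTheory.IsProbabilityMeasure (P δ)) → (∀ᶠ δ in (nhdsWithin (0:ℝ) (Set.Ioi 0)), AEMeasurable (fun ω => Literature.Probability.RandomPlanarGeometry.CurveClass.mk (X δ ω)) (P δ)) → (∀ᶠ δ in (nhdsWithin (0:ℝ) (Set.Ioi 0)), ∀ ω : Ω δ, Function.Injective (X δ ω) ∧ (X δ ω).source = D.pt 0 ∧ (X δ ω).target = D.pt 1 ∧ ∀ t : unitInterval, X δ ω t = D.pt 0 ∨ X δ ω t = D.pt 1 ∨ X δ ω t ∈ D.carrier) → (∀ T : NNReal, Literature.Probability.RandomPlanarGeometry.TendstoLaw (fun δ (ω : Ω δ) => ((⟨Literature.Probability.RandomPlanarGeometry.drivingFunction (φ) (Literature.Probability.RandomPlanarGeometry.CurveClass.mk (X δ ω)), Literature.Probability.RandomPlanarGeometry.continuous_drivingFunction (φ) (Literature.Probability.RandomPlanarGeometry.CurveClass.mk (X δ ω))⟩ : C(NNReal, ℝ)).restrict (Set.Icc (0:NNReal) T))) P (fun ω : NNReal → ℝ => ((⟨Literature.Probability.RandomPlanarGeometry.sleDriving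 ((8:NNReal)/3) ω, Literature.Probability.RandomPlanarGeometry.continuous_sleDriving ((8:NNReal)/3) ω⟩ : C(NNReal, ℝ)).restrict (Set.Icc (0:NNReal) T))) Literature.Probability.Process.preWienerMeasure) → (∀ T : NNReal, Literature.Probability.RandomPlanarGeometry.TendstoLaw (fun δ (ω : Ω δ) => ((⟨Literature.Probability.RandomPlanarGeometry.drivingFunction (φ') ((Literature.Probability.RandomPlanarGeometry.CurveClass.mk (X δ ω)).reverse), Literature.Probability.RandomPlanarGeometry.continuous_drivingFunction (φ') ((Literature.Probability.RandomPlanarGeometry.CurveClass.mk (X δ ω)).reverse)⟩ : C(NNReal, ℝ)).restrict (Set.Icc (0:NNReal) T))) P (fun ω : NNReal → ℝ => ((⟨Literature.Probability.RandomPlanarGeometry.sleDriving ((8:NNReal)/3) ω, Literature.Probability.RandomPlanarGeometry.continuous_sleDriving ((8:NNReal)/3) ω⟩ : C(NNReal, ℝ)).restrict (Set.Icc (0:NNReal) T))) Literature.Probability.Process.preWienerMeasure) → (∀ ε : ℝ, 0 < ε → ∀ η : ℝ, 0 < η → ∃ r : ℝ, 0 < r ∧ ∀ᶠ δ in (nhdsWithin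 (0:ℝ) (Set.Ioi 0)), P δ {ω | ∃ s t : unitInterval, s < t ∧ ε ≤ dist (X δ ω s) (D.pt 0) ∧ dist (X δ ω t) (D.pt 0) ≤ r} ≤ ENNReal.ofReal η) → (∀ ε : ℝ, 0 < ε → ∀ η : ℝ, 0 < η → ∃ r : ℝ, 0 < r ∧ ∀ᶠ δ in (nhdsWithin (0:ℝ) (Set.Ioi 0)), P δ {ω | ∃ s t : unitInterval, s < t ∧ dist (X δ ω s) (D.pt 1) ≤ r ∧ ε ≤ dist (X δ ω t) (D.pt 1)} ≤ ENNReal.ofReal η) → ∀ ℓ : ℝ, 0 < ℓ → ∀ η : ℝ, 0 < η → ∃ κ : ℝ, 0 < κ ∧ ∀ᶠ δ in (nhdsWithin (0:ℝ) (Set.Ioi 0)), P δ {ω | ∃ s u t : unitInterval, s < u ∧ u < t ∧ ℓ ≤ dist (X δ ω s) (X δ ω u) ∧ dist (X δ ω s) (X δ ω t) ≤ κ} ≤ ENNReal.ofReal η := by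
  intro D φ hφ φ' hφ' Ω _ X P H1 H2 H3 H4 H5 H6 H7 ℓ hℓ η hη
  classical
  have hκ0 : (0 : ℝ≥0) < (8 : ℝ≥0) / 3 := by positivity
  haveI : IsProbabilityMeasure Process.preWienerMeasure := isProbabilityMeasure_preWienerMeasure'
  /- ■ budget and constants -/
  obtain ⟨β, hβ, hβtop, h64, ηr, hηr, hηrβ⟩ := stub_returnsDie_budget η hη
  obtain ⟨ra, rb, ra', rb', raF, rbF, R2b, rbP, R2a, raP, rbW, rb'', ra'', N, T, T', α₀, α₀', hP1⟩ :=
    phase1_radii D φ hφ φ' hφ' Ω X P H6 H7 ℓ hℓ β hβ ηr hηr hηrβ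
  obtain ⟨p1f1, p1f2, p1f3, p1f4, p1f5, p1f6, p1f7, p1f8, p1f9, p1f10, p1f11, p1f12, p1f13, p1f14, p1f15, p1f16, p1f17, p1f18, p1f19, p1f20, p1f21, p1f22, p1f23, p1f24, p1f25, p1f26, p1f27, p1f28, p1f29, p1f30, p1f31, p1w1, p1w2, p1w3, p1w4, p1w5, p1w6, p1w7, p1e1, p1e2, p1e3, p1e4, p1e5, latF, latB⟩ := hP1
  obtain ⟨dB, dB', c, c₀, μ₀, c', c₁, μ₀', dS, d', h₀q, d'', h₀q', Rout, Rout', r₁, r₁', hP2⟩ :=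
    phase2a_coarse D φ hφ φ' hφ' T T' p1f25 p1f28 ℓ rbP rbW raP α₀ α₀' hℓ p1f14 p1f21 p1f22 p1f18 p1f30 p1f31 β hβ
  obtain ⟨p2af1, p2af2, p2af3, p2af4, p2af5, p2af6, p2af7, p2af8, p2af9, p2af10, p2af11, p2af12, p2af13, p2af14, p2af15, p2af16, p2af17, p2af18, p2af19, p2af20, p2af21, p2af22, p2af23, p2af24, p2af25, p2af26, p2af27, p2af28, p2af29, p2af30, p2af31, p2af32, p2af33, hgate, hgate', p2ae1, p2ae2, p2ae3, p2ae4, p2ae5, p2ae6, p2ae7, p2ae8, p2ae9⟩ := hP2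
  obtain ⟨τ, τ₁, θ, la, L, ρ₁, m₁, τ', τ₁', θ', la', L', ρ₁', m₁', w', μ', cν, ν, w, μ, hP3⟩ :=
    phase2b_fine D φ hφ φ' hφ' T T' p1f25 p1f28 c₀ c₁ r₁ r₁' p2af4 p2af6 p2af9 p2af11 p2af32 p2af33 β hβ
  obtain ⟨p2bf1, p2bf2, p2bf3, p2bf4, p2bf5, p2bf6, p2bf7, p2bf8, p2bf9, p2bf10, p2bf11, p2bf12, p2bf13, p2bf14, p2bf15, p2bf16, p2bf17, p2bf18, p2bf19, p2bf20, p2bf21, p2bf22, p2bb1, p2bb2, p2bb3, p2bb4, p2bb5, p2bb6, p2bb7, p2bb8, p2bb9, p2bb10, p2bb11, p2bb12, p2bb13, p2bb14, p2bb15, p2bb16, p2bb17, p2bb18, p2bb19, p2bb20, p2bb21, p2bl1, p2bl2, p2bl3, p2bl4, p2bl5, p2be1, p2be2, p2be3, p2be4, p2be5, p2be6, p2be7⟩ := hP3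
  obtain ⟨ε, ε', csh, csh', hP4⟩ :=
    phase3_eps D φ hφ φ' hφ' T T' N ℓ ra rb ra' rb' raF rbF R2b rbP R2a raP rbW α₀ α₀' dB dB' c c₀ μ₀ c' c₁ μ₀'
      dS d' h₀q d'' h₀q' Rout Rout' r₁ r₁' τ τ₁ θ la L ρ₁ m₁ τ' τ₁' θ' la' L' ρ₁' m₁' w' μ' cν ν w μ
      hℓ p1f30 p1f31 p1f1 p1f3 p1f7 p1f8 p1f9 p1f10 p1f11 p1f12 p1f2 p1f4 p1f13 p1f14 p1f15 p1f16 p1f17 p1f18 p1f19 p1f20 p1f21 p1f22 p1f26 p2af1 p2af2 p2af7 p2af12 p2af13 p2af14 p2af15 p2af16 p2af17 p2af18 p2af19 p2af20 p2af21 p2af22 p2af23 p2af24 p2af25 p2af26 p2af27 p2af29 p2af30 p2af32 p2af33 p2bf3 p2bf11 p2bf9 p2bf13 p2bf15 p2af28 p2bf17 p2bf18 p2bf19 p2bf20 p2bf21 p2bf22 p2bb3 p2bb11 p2bb9 p2bb13 p2bb15 p2af31 p2bb17 p2bb18 p2bb19 p2bb20 p2bb21 p2bl1 p2bl2 p2bl5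 β hβ
  obtain ⟨hnum, p3l1, p3l2, p3l3, p3l4, p3l5, p3l6, p3l7, p3l8, p3l9, p3l10, p3l11, p3l12, p3e1, p3e2⟩ := hP4
  have hε : 0 < ε := hnum.1
  have hε' : 0 < ε' := hnum.2.1
  refine ⟨ε, hε, ?_⟩
  /- ■ the restricted driving paths and the closed-set portmanteau, forward (`T + 2`) and backward (`T' + 2`) -/
  letI mSf : MeasurableSpace C(↥(Set.Icc (0:ℝ≥0) (T + 2)), ℝ) := borel _
  haveI : BorelSpace C(↥(Set.Icc (0:ℝ≥0) (T + 2)), ℝ) := ⟨rfl⟩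
  letI mSb : MeasurableSpace C(↥(Set.Icc (0:ℝ≥0) (T' + 2)), ℝ) := borel _
  haveI : BorelSpace C(↥(Set.Icc (0:ℝ≥0) (T' + 2)), ℝ) := ⟨rfl⟩
  obtain ⟨Yf, hYf⟩ : ∃ Yf : (δ : ℝ) → Ω δ → C(↥(Set.Icc (0:ℝ≥0) (T + 2)), ℝ), Yf = fun δ ω ↦
      ((⟨drivingFunction φ (CurveClass.mk (X δ ω)),
        continuous_drivingFunction φ (CurveClass.mk (X δ ω))⟩ : C(ℝ≥0, ℝ)).restrict
        (Set.Icc (0:ℝ≥0) (T + 2))) := ⟨_, rfl⟩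
  obtain ⟨Zf, hZf⟩ : ∃ Zf : (ℝ≥0 → ℝ) → C(↥(Set.Icc (0:ℝ≥0) (T + 2)), ℝ), Zf = fun ω ↦
      ((⟨sleDriving ((8:ℝ≥0)/3) ω, continuous_sleDriving ((8:ℝ≥0)/3) ω⟩ : C(ℝ≥0, ℝ)).restrict
        (Set.Icc (0:ℝ≥0) (T + 2))) := ⟨_, rfl⟩
  obtain ⟨Yb, hYb⟩ : ∃ Yb : (δ : ℝ) → Ω δ → C(↥(Set.Icc (0:ℝ≥0) (T' + 2)), ℝ), Yb = fun δ ω ↦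
      ((⟨drivingFunction φ' ((CurveClass.mk (X δ ω)).reverse),
        continuous_drivingFunction φ' ((CurveClass.mk (X δ ω)).reverse)⟩ : C(ℝ≥0, ℝ)).restrict
        (Set.Icc (0:ℝ≥0) (T' + 2))) := ⟨_, rfl⟩
  obtain ⟨Zb, hZb⟩ : ∃ Zb : (ℝ≥0 → ℝ) → C(↥(Set.Icc (0:ℝ≥0) (T' + 2)), ℝ), Zb = fun ω ↦
      ((⟨sleDriving ((8:ℝ≥0)/3) ω, continuous_sleDriving ((8:ℝ≥0)/3) ω⟩ : C(ℝ≥0, ℝ)).restrict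
        (Set.Icc (0:ℝ≥0) (T' + 2))) := ⟨_, rfl⟩
  have hYfm : ∀ᶠ δ in 𝓝[>] (0:ℝ), AEMeasurable (Yf δ) (P δ) := by
    filter_upwards [H2] with δ hδ
    rw [hYf]
    exact ((ContinuousMap.continuous_restrict _).measurable.comp
      (measurable_drivingPathOf hφ)).comp_aemeasurable hδ
  have hYbm : ∀ᶠ δ in 𝓝[>] (0:ℝ), AEMeasurable (Yb δ) (P δ) := by
    filter_upwards [H2] with δ hδ
    rw [hYb]
    exact ((ContinuousMap.continuous_restrict _).measurable.comp
      ((measurable_drivingPathOf hφ').comp CurveClass.measurable_reverse)).comp_aemeasurable hδ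
  have hZfm : AEMeasurable Zf Process.preWienerMeasure := by
    rw [hZf]
    exact ((ContinuousMap.continuous_restrict _).measurable.comp (measurable_drivingPath _)).aemeasurable
  have hZbm : AEMeasurable Zb Process.preWienerMeasure := by
    rw [hZb]
    exact ((ContinuousMap.continuous_restrict _).measurable.comp (measurable_drivingPath _)).aemeasurable
  have h4T : TendstoLaw Yf P Zf Process.preWienerMeasure := by rw [hYf, hZf]; exact H4 (T + 2)
  have h5T : TendstoLaw Yb P Zb Process.preWienerMeasure := by rw [hYb, hZb]; exact H5 (T' + 2)
  have hLCf := (stub_lawClosed C(↥(Set.Icc (0:ℝ≥0) (T + 2)), ℝ) Ω (ℝ≥0 → ℝ) Yf P Zf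
    Process.preWienerMeasure inferInstance H1 hYfm hZfm).1 h4T
  have hLCb := (stub_lawClosed C(↥(Set.Icc (0:ℝ≥0) (T' + 2)), ℝ) Ω (ℝ≥0 → ℝ) Yb P Zb
    Process.preWienerMeasure inferInstance H1 hYbm hZbm).1 h5T
  /- ■ the bad driver sets -/
  obtain ⟨A₀, hA₀⟩ : ∃ A₀ : Set C(↥(Set.Icc (0:ℝ≥0) (T + 2)), ℝ), A₀ = {wr : C(↥(Set.Icc (0:NNReal) (T + 2)), ℝ) | ∃ (W' : NNReal → ℝ) (hW' : Continuous W'), (⟨W', hW'⟩ : C(NNReal, ℝ)).restrict (Set.Icc (0:NNReal) (T + 2)) = wr ∧ ∀ ρ : NNReal → ℂ, ¬ ((Continuous ρ ∧ (∀ u : NNReal, 0 ≤ (ρ u).im) ∧ ρ 0 = 0 ∧ (∀ t : NNReal, 0 < t → (t : ℝ) ≤ T + 1 → Metric.hausdorffDist (φ.boundaryExtension '' closure (Literature.Probability.RandomPlanarGeometry.Loewner.hull W' t)) ((fun u => φ.boundaryExtension (ρ u)) '' Set.Icc 0 t) ≤ ε) ∧ (∀ s t : NNReal, (s : ℝ)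 ≤ T + 1 → (t : ℝ) ≤ T + 1 → w ≤ |(s : ℝ) - t| → μ ≤ dist (φ.boundaryExtension (ρ s)) (φ.boundaryExtension (ρ t))) ∧ (∀ s t : NNReal, (s : ℝ) ≤ T + 1 → (t : ℝ) ≤ T + 1 → c₀ / 4 ≤ |(s : ℝ) - t| → μ₀ ≤ dist (φ.boundaryExtension (ρ s)) (φ.boundaryExtension (ρ t))) ∧ (∀ s s' : NNReal, (s : ℝ) ≤ T + 1 → (s' : ℝ) ≤ T + 1 → |(s : ℝ) - s'| ≤ θ + 4 * w → |W' s - W' s'| ≤ ρ₁) ∧ (∀ t₁ : NNReal, (t₁ : ℝ) ≤ T → ∃ u : NNReal, (t₁ : ℝ) + 2 * θ ≤ u ∧ (u : ℝ) ≤ t₁ + L * θ ∧ ρ u ∈ Literature.Probability.RandomPlanarGeometry.Loewner.domain W' t₁ ∧ m₁ ≤ ‖Literature.Probability.RandomPlanarGeometry.Loewner.map W' t₁ (ρ u) - W' t₁‖) ∧ (∀ t₁ : NNReal, (t₁ : ℝ) ≤ T → ∀ e ∈ D.carrier, d' ≤ Metric.infDist e ((fun u => φ.boundaryExtension (ρ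 u)) '' Set.Icc 0 (T + 1) ∪ frontier D.carrier) → φ.symm e ∈ Literature.Probability.RandomPlanarGeometry.Loewner.domain W' t₁ ∧ (h₀q / 2) ≤ (Literature.Probability.RandomPlanarGeometry.Loewner.map W' t₁ (φ.symm e)).im) ∧ (∀ u : NNReal, α₀ / 2 ≤ (u : ℝ) → (u : ℝ) ≤ T + 1 → dB ≤ Metric.infDist (φ.boundaryExtension (ρ u)) (frontier D.carrier)) ∧ (∀ u : NNReal, (u : ℝ) ≤ T + 1 → (u : ℝ) < α₀ → dist (φ.boundaryExtension (ρ u)) (D.pt 0) < raP - ε)) ∧ ((∀ s t : NNReal, (s : ℝ) ≤ T + 1 → (t : ℝ) ≤ T + 1 → c₀ ≤ |(s : ℝ) - t| → μ₀ ≤ dist (φ.boundaryExtension (ρ s)) (φ.boundaryExtension (ρ t))) ∧ (∀ s t : NNReal, (s : ℝ) ≤ T + 1 → (t : ℝ) ≤ T + 1 → |(s : ℝ) - t| ≤ 2 * w → dist (φ.boundaryExtension (ρ s)) (φ.boundaryExtension (ρ t)) ≤ ν) ∧ (∀ s t : NNReal, (s : ℝ) ≤ T + 1 → (t : ℝ)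 ≤ T + 1 → |(s : ℝ) - t| < 9 * c₀ + w → dist (φ.boundaryExtension (ρ s)) (φ.boundaryExtension (ρ t)) < ℓ - 2 * ε) ∧ (∀ u' u : NNReal, u' ≤ u → (u : ℝ) ≤ T + 1 → raF - ε ≤ dist (φ.boundaryExtension (ρ u')) (D.pt 0) → raP + ε + 2 * dS ≤ dist (φ.boundaryExtension (ρ u)) (D.pt 0)) ∧ (∀ u : NNReal, (u : ℝ) ≤ T + 1 → (N : ℝ) < (u : ℝ) → dist (φ.boundaryExtension (ρ u)) (D.pt 1) < rbF - ε) ∧ (∀ u u' : NNReal, u ≤ u' → (u' : ℝ) ≤ T + 1 → rbF - ε ≤ dist (φ.boundaryExtension (ρ u')) (D.pt 1) → rbP + ε + 2 * dS ≤ dist (φ.boundaryExtension (ρ u)) (D.pt 1)) ∧ (dist (φ.boundaryExtension (ρ (T + 1))) (D.pt 1) + ε ≤ rbW) ∧ (∀ (y : ℂ) (u : NNReal), α₀ ≤ (u : ℝ) → (u : ℝ) ≤ (N : ℝ) + w → dist y (φ.boundaryExtension (ρ u)) ≤ ε → ∃ e ∈ D.carrier, dist e y ≤ 2 * dS ∧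 d' ≤ Metric.infDist e ((fun u => φ.boundaryExtension (ρ u)) '' Set.Icc 0 (T + 1) ∪ frontier D.carrier))))} := ⟨_, rfl⟩
  obtain ⟨A₀', hA₀'⟩ : ∃ A₀' : Set C(↥(Set.Icc (0:ℝ≥0) (T' + 2)), ℝ), A₀' = {wr : C(↥(Set.Icc (0:NNReal) (T' + 2)), ℝ) | ∃ (W' : NNReal → ℝ) (hW' : Continuous W'), (⟨W', hW'⟩ : C(NNReal, ℝ)).restrict (Set.Icc (0:NNReal) (T' + 2)) = wr ∧ ∀ ρ : NNReal → ℂ, ¬ ((Continuous ρ ∧ (∀ u : NNReal, 0 ≤ (ρ u).im) ∧ ρ 0 = 0 ∧ (∀ t : NNReal, 0 < t → (t : ℝ) ≤ T' + 1 → Metric.hausdorffDist (φ'.boundaryExtension '' closure (Literature.Probability.RandomPlanarGeometry.Loewner.hull W' t)) ((fun u => φ'.boundaryExtension (ρ u)) '' Set.Icc 0 t) ≤ ε') ∧ (∀ s t : NNReal, (s : ℝ) ≤ T' + 1 → (t : ℝ) ≤ T' + 1 → w' ≤ |(s : ℝ) - t| → μ' ≤ dist (φ'.boundaryExtension (ρ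 s)) (φ'.boundaryExtension (ρ t))) ∧ (∀ s t : NNReal, (s : ℝ) ≤ T' + 1 → (t : ℝ) ≤ T' + 1 → c₁ / 4 ≤ |(s : ℝ) - t| → μ₀' ≤ dist (φ'.boundaryExtension (ρ s)) (φ'.boundaryExtension (ρ t))) ∧ (∀ s s' : NNReal, (s : ℝ) ≤ T' + 1 → (s' : ℝ) ≤ T' + 1 → |(s : ℝ) - s'| ≤ θ' + 4 * w' → |W' s - W' s'| ≤ ρ₁') ∧ (∀ t₁ : NNReal, (t₁ : ℝ) ≤ T' → ∃ u : NNReal, (t₁ : ℝ) + 2 * θ' ≤ u ∧ (u : ℝ) ≤ t₁ + L' * θ' ∧ ρ u ∈ Literature.Probability.RandomPlanarGeometry.Loewner.domain W' t₁ ∧ m₁' ≤ ‖Literature.Probability.RandomPlanarGeometry.Loewner.map W' t₁ (ρ u) - W' t₁‖) ∧ (∀ t₁ : NNReal, (t₁ : ℝ) ≤ T' → ∀ e ∈ D.swap.carrier, d'' ≤ Metric.infDist e ((fun u => φ'.boundaryExtension (ρ u)) '' Set.Icc 0 (T' + 1) ∪ frontier D.swap.carrier) → φ'.symm e ∈ Literature.Probability.RandomPlanarGeometry.Loewner.domain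 W' t₁ ∧ (h₀q' / 2) ≤ (Literature.Probability.RandomPlanarGeometry.Loewner.map W' t₁ (φ'.symm e)).im) ∧ (∀ u : NNReal, α₀' / 2 ≤ (u : ℝ) → (u : ℝ) ≤ T' + 1 → dB' ≤ Metric.infDist (φ'.boundaryExtension (ρ u)) (frontier D.swap.carrier)) ∧ (∀ u : NNReal, (u : ℝ) ≤ T' + 1 → (u : ℝ) < α₀' → dist (φ'.boundaryExtension (ρ u)) (D.swap.pt 0) < rbP - ε')) ∧ (∀ s t : NNReal, (s : ℝ) ≤ T' + 1 → (t : ℝ) ≤ T' + 1 → |(s : ℝ) - t| ≤ c₁ → dist (φ'.boundaryExtension (ρ s)) (φ'.boundaryExtension (ρ t)) < μ₀ / 2))} := ⟨_, rfl⟩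
  have e1 := hLCf (closure A₀) isClosed_closure β hβ
  have e2 := hLCf {0} isClosed_singleton β hβ
  have e3 := hLCb (closure A₀') isClosed_closure β hβ
  have e4 := hLCb {0} isClosed_singleton β hβ
  /- ■ SLE side -/
  set F1 : Set (NNReal → ℝ) := {ω | ∃ s t : NNReal, (s : ℝ) ≤ (T + 1) + 1 ∧ (t : ℝ) ≤ (T + 1) + 1 ∧ |(s : ℝ) - t| ≤ csh ∧ ε / 4 ≤ dist (φ.boundaryExtension (Literature.Probability.RandomPlanarGeometry.sleTrace ((8:NNReal)/3) ω s)) (φ.boundaryExtension (Literature.Probability.RandomPlanarGeometry.sleTrace ((8:NNReal)/3) ω t))} with hF1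
  set F2 : Set (NNReal → ℝ) := {ω | ∃ s t : NNReal, (s : ℝ) ≤ T + 1 ∧ (t : ℝ) ≤ T + 1 ∧ w ≤ |(s : ℝ) - t| ∧ dist (φ.boundaryExtension (Literature.Probability.RandomPlanarGeometry.sleTrace ((8:NNReal)/3) ω s)) (φ.boundaryExtension (Literature.Probability.RandomPlanarGeometry.sleTrace ((8:NNReal)/3) ω t)) < μ} with hF2
  set F3 : Set (NNReal → ℝ) := {ω | ∃ s t : NNReal, (s : ℝ) ≤ T + 1 ∧ (t : ℝ) ≤ T + 1 ∧ c₀ / 4 ≤ |(s : ℝ) - t| ∧ dist (φ.boundaryExtension (Literature.Probability.RandomPlanarGeometry.sleTrace ((8:NNReal)/3) ω s)) (φ.boundaryExtension (Literature.Probability.RandomPlanarGeometry.sleTrace ((8:NNReal)/3) ω t)) < μ₀} with hF3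
  set F4 : Set (NNReal → ℝ) := {ω | ∃ s s' : NNReal, (s : ℝ) ≤ T + 1 ∧ (s' : ℝ) ≤ T + 1 ∧ |(s : ℝ) - s'| ≤ τ₁ ∧ ρ₁ / 2 < |Literature.Probability.RandomPlanarGeometry.sleDriving ((8:NNReal)/3) ω s - Literature.Probability.RandomPlanarGeometry.sleDriving ((8:NNReal)/3) ω s'|} with hF4
  set F5 : Set (NNReal → ℝ) := {ω | ∃ s s' : NNReal, (s : ℝ) ≤ T + 1 ∧ (s' : ℝ) ≤ T + 1 ∧ |(s : ℝ) - s'| ≤ τ ∧ Real.sqrt la / 200 < |Literature.Probability.RandomPlanarGeometry.sleDriving ((8:NNReal)/3) ω s - Literature.Probability.RandomPlanarGeometry.sleDriving ((8:NNReal)/3) ω s'|} with hF5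
  set F6 : Set (NNReal → ℝ) := {ω | ∃ e ∈ D.carrier, d' ≤ Metric.infDist e ((fun v => φ.boundaryExtension (Literature.Probability.RandomPlanarGeometry.sleTrace ((8:NNReal)/3) ω v)) '' Set.Icc 0 (T + 1) ∪ frontier D.carrier) ∧ ¬ (((T : NNReal) : WithTop NNReal) < Literature.Probability.RandomPlanarGeometry.Loewner.swallowingTime (Literature.Probability.RandomPlanarGeometry.sleDriving ((8:NNReal)/3) ω) (φ.symm e) ∧ h₀q ≤ (Literature.Probability.RandomPlanarGeometry.Loewner.map (Literature.Probability.RandomPlanarGeometry.sleDriving ((8:NNReal)/3) ω) T (φ.symm e)).im)} with hF6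
  set F7 : Set (NNReal → ℝ) := {ω | ∃ u : NNReal, α₀ / 2 ≤ (u : ℝ) ∧ (u : ℝ) ≤ T + 1 ∧ Metric.infDist (φ.boundaryExtension (Literature.Probability.RandomPlanarGeometry.sleTrace ((8:NNReal)/3) ω u)) (frontier D.carrier) < dB} with hF7
  set F8 : Set (NNReal → ℝ) := {ω | ∃ u : NNReal, (u : ℝ) ≤ α₀ ∧ raP / 2 ≤ dist (φ.boundaryExtension (Literature.Probability.RandomPlanarGeometry.sleTrace ((8:NNReal)/3) ω u)) (D.pt 0)} with hF8
  set F9 : Set (NNReal → ℝ) := {ω | ∃ s t : NNReal, (s : ℝ) ≤ T + 1 ∧ (t : ℝ) ≤ T + 1 ∧ |(s : ℝ) - t| ≤ cν ∧ ν ≤ dist (φ.boundaryExtension (Literature.Probability.RandomPlanarGeometry.sleTrace ((8:NNReal)/3) ω s)) (φ.boundaryExtension (Literature.Probability.RandomPlanarGeometry.sleTrace ((8:NNReal)/3) ω t))} with hF9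
  set F10 : Set (NNReal → ℝ) := {ω | ∃ s t : NNReal, (s : ℝ) ≤ T + 1 ∧ (t : ℝ) ≤ T + 1 ∧ |(s : ℝ) - t| ≤ c ∧ ℓ / 2 ≤ dist (φ.boundaryExtension (Literature.Probability.RandomPlanarGeometry.sleTrace ((8:NNReal)/3) ω s)) (φ.boundaryExtension (Literature.Probability.RandomPlanarGeometry.sleTrace ((8:NNReal)/3) ω t))} with hF10
  set F11 : Set (NNReal → ℝ) := {ω | ∃ u' u : NNReal, u' ≤ u ∧ raF / 2 < dist (φ.boundaryExtension (Literature.Probability.RandomPlanarGeometry.sleTrace ((8:NNReal)/3) ω u')) (D.pt 0) ∧ dist (φ.boundaryExtension (Literature.Probability.RandomPlanarGeometry.sleTrace ((8:NNReal)/3) ω u)) (D.pt 0) < R2a} with hF11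
  set F12 : Set (NNReal → ℝ) := {ω | ∃ t : NNReal, ((N : ℕ) : NNReal) ≤ t ∧ rbW / 2 < dist (φ.boundaryExtension (Literature.Probability.RandomPlanarGeometry.sleTrace ((8:NNReal)/3) ω t)) (D.pt 1)} with hF12
  set F13 : Set (NNReal → ℝ) := {ω | ∃ u u' : NNReal, u ≤ u' ∧ rbF / 2 < dist (φ.boundaryExtension (Literature.Probability.RandomPlanarGeometry.sleTrace ((8:NNReal)/3) ω u')) (D.pt 1) ∧ dist (φ.boundaryExtension (Literature.Probability.RandomPlanarGeometry.sleTrace ((8:NNReal)/3) ω u)) (D.pt 1) < R2b} with hF13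
  set F14 : Set (NNReal → ℝ) := {ω | ∃ u : NNReal, (u : ℝ) ≤ T + 1 ∧ ∀ e ∈ D.carrier, dist e (φ.boundaryExtension (Literature.Probability.RandomPlanarGeometry.sleTrace ((8:NNReal)/3) ω u)) ≤ dS → Metric.infDist e ((fun v => φ.boundaryExtension (Literature.Probability.RandomPlanarGeometry.sleTrace ((8:NNReal)/3) ω v)) '' Set.Icc 0 (T + 1) ∪ frontier D.carrier) < d'} with hF14
  set Bk1 : Set (NNReal → ℝ) := {ω | ∃ s t : NNReal, (s : ℝ) ≤ (T' + 1) + 1 ∧ (t : ℝ) ≤ (T' + 1) + 1 ∧ |(s : ℝ) - t| ≤ csh' ∧ ε' / 4 ≤ dist (φ'.boundaryExtension (Literature.Probability.RandomPlanarGeometry.sleTrace ((8:NNReal)/3) ω s)) (φ'.boundaryExtension (Literature.Probability.RandomPlanarGeometry.sleTrace ((8:NNReal)/3) ω t))} with hBk1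
  set Bk2 : Set (NNReal → ℝ) := {ω | ∃ s t : NNReal, (s : ℝ) ≤ T' + 1 ∧ (t : ℝ) ≤ T' + 1 ∧ w' ≤ |(s : ℝ) - t| ∧ dist (φ'.boundaryExtension (Literature.Probability.RandomPlanarGeometry.sleTrace ((8:NNReal)/3) ω s)) (φ'.boundaryExtension (Literature.Probability.RandomPlanarGeometry.sleTrace ((8:NNReal)/3) ω t)) < μ'} with hBk2
  set Bk3 : Set (NNReal → ℝ) := {ω | ∃ s t : NNReal, (s : ℝ) ≤ T' + 1 ∧ (t : ℝ) ≤ T' + 1 ∧ c₁ / 4 ≤ |(s : ℝ) - t| ∧ dist (φ'.boundaryExtension (Literature.Probability.RandomPlanarGeometry.sleTrace ((8:NNReal)/3) ω s)) (φ'.boundaryExtension (Literature.Probability.RandomPlanarGeometry.sleTrace ((8:NNReal)/3) ω t)) < μ₀'} with hBk3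
  set Bk4 : Set (NNReal → ℝ) := {ω | ∃ s s' : NNReal, (s : ℝ) ≤ T' + 1 ∧ (s' : ℝ) ≤ T' + 1 ∧ |(s : ℝ) - s'| ≤ τ₁' ∧ ρ₁' / 2 < |Literature.Probability.RandomPlanarGeometry.sleDriving ((8:NNReal)/3) ω s - Literature.Probability.RandomPlanarGeometry.sleDriving ((8:NNReal)/3) ω s'|} with hBk4
  set Bk5 : Set (NNReal → ℝ) := {ω | ∃ s s' : NNReal, (s : ℝ) ≤ T' + 1 ∧ (s' : ℝ) ≤ T' + 1 ∧ |(s : ℝ) - s'| ≤ τ' ∧ Real.sqrt la' / 200 < |Literature.Probability.RandomPlanarGeometry.sleDriving ((8:NNReal)/3) ω s - Literature.Probability.RandomPlanarGeometry.sleDriving ((8:NNReal)/3) ω s'|} with hBk5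
  set Bk6 : Set (NNReal → ℝ) := {ω | ∃ e ∈ D.swap.carrier, d'' ≤ Metric.infDist e ((fun v => φ'.boundaryExtension (Literature.Probability.RandomPlanarGeometry.sleTrace ((8:NNReal)/3) ω v)) '' Set.Icc 0 (T' + 1) ∪ frontier D.swap.carrier) ∧ ¬ (((T' : NNReal) : WithTop NNReal) < Literature.Probability.RandomPlanarGeometry.Loewner.swallowingTime (Literature.Probability.RandomPlanarGeometry.sleDriving ((8:NNReal)/3) ω) (φ'.symm e) ∧ h₀q' ≤ (Literature.Probability.RandomPlanarGeometry.Loewner.map (Literature.Probability.RandomPlanarGeometry.sleDriving ((8:NNReal)/3) ω) T' (φ'.symm e)).im)} with hBk6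
  set Bk7 : Set (NNReal → ℝ) := {ω | ∃ u : NNReal, α₀' / 2 ≤ (u : ℝ) ∧ (u : ℝ) ≤ T' + 1 ∧ Metric.infDist (φ'.boundaryExtension (Literature.Probability.RandomPlanarGeometry.sleTrace ((8:NNReal)/3) ω u)) (frontier D.swap.carrier) < dB'} with hBk7
  set Bk8 : Set (NNReal → ℝ) := {ω | ∃ u : NNReal, (u : ℝ) ≤ α₀' ∧ rbP / 2 ≤ dist (φ'.boundaryExtension (Literature.Probability.RandomPlanarGeometry.sleTrace ((8:NNReal)/3) ω u)) (D.swap.pt 0)} with hBk8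
  set Bk9 : Set (NNReal → ℝ) := {ω | ∃ s t : NNReal, (s : ℝ) ≤ T' + 1 ∧ (t : ℝ) ≤ T' + 1 ∧ |(s : ℝ) - t| ≤ c' ∧ μ₀ / 2 ≤ dist (φ'.boundaryExtension (Literature.Probability.RandomPlanarGeometry.sleTrace ((8:NNReal)/3) ω s)) (φ'.boundaryExtension (Literature.Probability.RandomPlanarGeometry.sleTrace ((8:NNReal)/3) ω t))} with hBk9
  have hBF : Literature.Probability.Process.preWienerMeasure (F1 ∪ F2 ∪ F3 ∪ F4 ∪ F5 ∪ F6 ∪ F7 ∪ F8 ∪ F9 ∪ F10 ∪ F11 ∪ F12 ∪ F13 ∪ F14) ≤ 14 * β := by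
    have s1 : Literature.Probability.Process.preWienerMeasure F1 ≤ 1 * β := by rw [one_mul]; exact p3e1
    have s2 : Literature.Probability.Process.preWienerMeasure (F1 ∪ F2) ≤ 2 * β :=
      (MeasureTheory.measure_union_le _ _).trans ((add_le_add s1 p2be7).trans_eq (by ring))
    have s3 : Literature.Probability.Process.preWienerMeasure (F1 ∪ F2 ∪ F3) ≤ 3 * β :=
      (MeasureTheory.measure_union_le _ _).trans ((add_le_add s2 p2ae3).trans_eq (by ring))
    have s4 : Literature.Probability.Process.preWienerMeasure (F1 ∪ F2 ∪ F3 ∪ F4) ≤ 4 * β :=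
      (MeasureTheory.measure_union_le _ _).trans ((add_le_add s3 p2be2).trans_eq (by ring))
    have s5 : Literature.Probability.Process.preWienerMeasure (F1 ∪ F2 ∪ F3 ∪ F4 ∪ F5) ≤ 5 * β :=
      (MeasureTheory.measure_union_le _ _).trans ((add_le_add s4 p2be1).trans_eq (by ring))
    have s6 : Literature.Probability.Process.preWienerMeasure (F1 ∪ F2 ∪ F3 ∪ F4 ∪ F5 ∪ F6) ≤ 6 * β :=
      (MeasureTheory.measure_union_le _ _).trans ((add_le_add s5 p2ae5).trans_eq (by ring))
    have s7 : Literature.Probability.Process.preWienerMeasure (F1 ∪ F2 ∪ F3 ∪ F4 ∪ F5 ∪ F6 ∪ F7) ≤ 7 * β :=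
      (MeasureTheory.measure_union_le _ _).trans ((add_le_add s6 p2ae1).trans_eq (by ring))
    have s8 : Literature.Probability.Process.preWienerMeasure (F1 ∪ F2 ∪ F3 ∪ F4 ∪ F5 ∪ F6 ∪ F7 ∪ F8) ≤ 8 * β :=
      (MeasureTheory.measure_union_le _ _).trans ((add_le_add s7 p1e4).trans_eq (by ring))
    have s9 : Literature.Probability.Process.preWienerMeasure (F1 ∪ F2 ∪ F3 ∪ F4 ∪ F5 ∪ F6 ∪ F7 ∪ F8 ∪ F9) ≤ 9 * β :=
      (MeasureTheory.measure_union_le _ _).trans ((add_le_add s8 p2be6).trans_eq (by ring))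
    have s10 : Literature.Probability.Process.preWienerMeasure (F1 ∪ F2 ∪ F3 ∪ F4 ∪ F5 ∪ F6 ∪ F7 ∪ F8 ∪ F9 ∪ F10) ≤ 10 * β :=
      (MeasureTheory.measure_union_le _ _).trans ((add_le_add s9 p2ae2).trans_eq (by ring))
    have s11 : Literature.Probability.Process.preWienerMeasure (F1 ∪ F2 ∪ F3 ∪ F4 ∪ F5 ∪ F6 ∪ F7 ∪ F8 ∪ F9 ∪ F10 ∪ F11) ≤ 11 * β :=
      (MeasureTheory.measure_union_le _ _).trans ((add_le_add s10 p1e2).trans_eq (by ring))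
    have s12 : Literature.Probability.Process.preWienerMeasure (F1 ∪ F2 ∪ F3 ∪ F4 ∪ F5 ∪ F6 ∪ F7 ∪ F8 ∪ F9 ∪ F10 ∪ F11 ∪ F12) ≤ 12 * β :=
      (MeasureTheory.measure_union_le _ _).trans ((add_le_add s11 p1e3).trans_eq (by ring))
    have s13 : Literature.Probability.Process.preWienerMeasure (F1 ∪ F2 ∪ F3 ∪ F4 ∪ F5 ∪ F6 ∪ F7 ∪ F8 ∪ F9 ∪ F10 ∪ F11 ∪ F12 ∪ F13) ≤ 13 * β :=
      (MeasureTheory.measure_union_le _ _).trans ((add_le_add s12 p1e1).trans_eq (by ring))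
    have s14 : Literature.Probability.Process.preWienerMeasure (F1 ∪ F2 ∪ F3 ∪ F4 ∪ F5 ∪ F6 ∪ F7 ∪ F8 ∪ F9 ∪ F10 ∪ F11 ∪ F12 ∪ F13 ∪ F14) ≤ 14 * β :=
      (MeasureTheory.measure_union_le _ _).trans ((add_le_add s13 p2ae4).trans_eq (by ring))
    exact s14
  have hBB : Literature.Probability.Process.preWienerMeasure (Bk1 ∪ Bk2 ∪ Bk3 ∪ Bk4 ∪ Bk5 ∪ Bk6 ∪ Bk7 ∪ Bk8 ∪ Bk9) ≤ 9 * β := by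
    have s1 : Literature.Probability.Process.preWienerMeasure Bk1 ≤ 1 * β := by rw [one_mul]; exact p3e2
    have s2 : Literature.Probability.Process.preWienerMeasure (Bk1 ∪ Bk2) ≤ 2 * β :=
      (MeasureTheory.measure_union_le _ _).trans ((add_le_add s1 p2be5).trans_eq (by ring))
    have s3 : Literature.Probability.Process.preWienerMeasure (Bk1 ∪ Bk2 ∪ Bk3) ≤ 3 * β :=
      (MeasureTheory.measure_union_le _ _).trans ((add_le_add s2 p2ae8).trans_eq (by ring))
    have s4 : Literature.Probability.Process.preWienerMeasure (Bk1 ∪ Bk2 ∪ Bk3 ∪ Bk4) ≤ 4 * β :=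
      (MeasureTheory.measure_union_le _ _).trans ((add_le_add s3 p2be4).trans_eq (by ring))
    have s5 : Literature.Probability.Process.preWienerMeasure (Bk1 ∪ Bk2 ∪ Bk3 ∪ Bk4 ∪ Bk5) ≤ 5 * β :=
      (MeasureTheory.measure_union_le _ _).trans ((add_le_add s4 p2be3).trans_eq (by ring))
    have s6 : Literature.Probability.Process.preWienerMeasure (Bk1 ∪ Bk2 ∪ Bk3 ∪ Bk4 ∪ Bk5 ∪ Bk6) ≤ 6 * β :=
      (MeasureTheory.measure_union_le _ _).trans ((add_le_add s5 p2ae9).trans_eq (by ring))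
    have s7 : Literature.Probability.Process.preWienerMeasure (Bk1 ∪ Bk2 ∪ Bk3 ∪ Bk4 ∪ Bk5 ∪ Bk6 ∪ Bk7) ≤ 7 * β :=
      (MeasureTheory.measure_union_le _ _).trans ((add_le_add s6 p2ae6).trans_eq (by ring))
    have s8 : Literature.Probability.Process.preWienerMeasure (Bk1 ∪ Bk2 ∪ Bk3 ∪ Bk4 ∪ Bk5 ∪ Bk6 ∪ Bk7 ∪ Bk8) ≤ 8 * β :=
      (MeasureTheory.measure_union_le _ _).trans ((add_le_add s7 p1e5).trans_eq (by ring))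
    have s9 : Literature.Probability.Process.preWienerMeasure (Bk1 ∪ Bk2 ∪ Bk3 ∪ Bk4 ∪ Bk5 ∪ Bk6 ∪ Bk7 ∪ Bk8 ∪ Bk9) ≤ 9 * β :=
      (MeasureTheory.measure_union_le _ _).trans ((add_le_add s8 p2ae7).trans_eq (by ring))
    exact s9
  have hMF := phase4_marginsF D φ T N ℓ ε μ μ₀ w c₀ θ ρ₁ d' h₀q α₀ dB raP raF rbF rbP rbW dS R2a R2b la τ τ₁ c cν ν csh
    (p2af4).le (p2bf19).le p2bl4 (by linarith [p2af5, p2bf21, p2af4]) p3l12 p3l5 p3l7 p3l6 p3l8 p3l9 p1f26 p3l10 (by linarith [p1f26, p2bf22]) p3l11 p2bf4 p2bf16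
  have hMB := phase4_marginsB D φ' T' ε' μ' μ₀' w' c₁ θ' ρ₁' d'' h₀q' α₀' dB' rbP μ₀ la' τ' τ₁' c' csh'
    p2bb4 p2bb16 p2af10
  have hSLEf : Process.preWienerMeasure (Zf ⁻¹' closure A₀) ≤ 14 * β := by
    rw [hZf, hA₀]
    refine le_trans ?_ hBF
    exact PathUpgradeRSLEGood.measure_closure_badDrivers_le D φ hφ T p1f25 ε μ μ₀ w c₀ θ ρ₁ m₁ d' (h₀q / 2)
      α₀ dB raP L la csh (raP / 2) (Real.sqrt la / 200) hε p3l1 p2bf3 p2bf6 p2bf7 p2bf8 p2bf13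
      (by positivity) le_rfl p2bf10 (le_of_eq p2bf14) p2af20 (by linarith [p2af21]) p3l3
      (fun ρ : NNReal → ℂ => ((∀ s t : NNReal, (s : ℝ) ≤ T + 1 → (t : ℝ) ≤ T + 1 → c₀ ≤ |(s : ℝ) - t| → μ₀ ≤ dist (φ.boundaryExtension (ρ s)) (φ.boundaryExtension (ρ t))) ∧ (∀ s t : NNReal, (s : ℝ) ≤ T + 1 → (t : ℝ) ≤ T + 1 → |(s : ℝ) - t| ≤ 2 * w → dist (φ.boundaryExtension (ρ s)) (φ.boundaryExtension (ρ t)) ≤ ν) ∧ (∀ s t : NNReal, (s : ℝ) ≤ T + 1 → (t : ℝ) ≤ T + 1 → |(s : ℝ) - t| < 9 * c₀ + w → dist (φ.boundaryExtension (ρ s)) (φ.boundaryExtension (ρ t)) < ℓ - 2 * ε) ∧ (∀ u' u : NNReal, u' ≤ u → (u : ℝ) ≤ T + 1 → raF - ε ≤ dist (φ.boundaryExtension (ρ u')) (D.pt 0) → raP + ε + 2 * dS ≤ dist (φ.boundaryExtension (ρ u)) (D.pt 0)) ∧ (∀ u : NNReal, (u : ℝ) ≤ T + 1 → (N : ℝ)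 < (u : ℝ) → dist (φ.boundaryExtension (ρ u)) (D.pt 1) < rbF - ε) ∧ (∀ u u' : NNReal, u ≤ u' → (u' : ℝ) ≤ T + 1 → rbF - ε ≤ dist (φ.boundaryExtension (ρ u')) (D.pt 1) → rbP + ε + 2 * dS ≤ dist (φ.boundaryExtension (ρ u)) (D.pt 1)) ∧ (dist (φ.boundaryExtension (ρ (T + 1))) (D.pt 1) + ε ≤ rbW) ∧ (∀ (y : ℂ) (u : NNReal), α₀ ≤ (u : ℝ) → (u : ℝ) ≤ (N : ℝ) + w → dist y (φ.boundaryExtension (ρ u)) ≤ ε → ∃ e ∈ D.carrier, dist e y ≤ 2 * dS ∧ d' ≤ Metric.infDist e ((fun u => φ.boundaryExtension (ρ u)) '' Set.Icc 0 (T + 1) ∪ frontier D.carrier)))) (F1 ∪ F2 ∪ F3 ∪ F4 ∪ F5 ∪ F6 ∪ F7 ∪ F8 ∪ F9 ∪ F10 ∪ F11 ∪ F12 ∪ F13 ∪ F14) hMF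
  have hSLEb : Process.preWienerMeasure (Zb ⁻¹' closure A₀') ≤ 9 * β := by
    rw [hZb, hA₀']
    refine le_trans ?_ hBB
    exact PathUpgradeRSLEGood.measure_closure_badDrivers_le D.swap φ' hφ' T' p1f28 ε' μ' μ₀' w' c₁ θ' ρ₁' m₁'
      d'' (h₀q' / 2) α₀' dB' rbP L' la' csh' (rbP / 2) (Real.sqrt la' / 200) hε' p3l2 p2bb3 p2bb6 p2bb7
      p2bb8 p2bb13 (by positivity) le_rfl p2bb10 (le_of_eq p2bb14) p2af22 (by linarith [p2af25]) p3l4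
      (fun ρ : NNReal → ℂ => (∀ s t : NNReal, (s : ℝ) ≤ T' + 1 → (t : ℝ) ≤ T' + 1 → |(s : ℝ) - t| ≤ c₁ → dist (φ'.boundaryExtension (ρ s)) (φ'.boundaryExtension (ρ t)) < μ₀ / 2)) (Bk1 ∪ Bk2 ∪ Bk3 ∪ Bk4 ∪ Bk5 ∪ Bk6 ∪ Bk7 ∪ Bk8 ∪ Bk9) hMB
  have hT2 : T + 2 ≠ 0 := ne_of_gt (by positivity)
  have hT'2 : T' + 2 ≠ 0 := ne_of_gt (by positivity)
  have hSLE0f : Process.preWienerMeasure (Zf ⁻¹' {0}) = 0 := by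
    refine measure_mono_null (fun ω hω ↦ ?_) (measure_sleDriving_apply_eq_zero _ hκ0 hT2)
    rw [mem_preimage, mem_singleton_iff, hZf] at hω
    have h := congrArg (fun w : C(↥(Set.Icc (0:ℝ≥0) (T + 2)), ℝ) ↦ w ⟨T + 2, ⟨zero_le, le_rfl⟩⟩) hω
    simpa using h
  have hSLE0b : Process.preWienerMeasure (Zb ⁻¹' {0}) = 0 := by
    refine measure_mono_null (fun ω hω ↦ ?_) (measure_sleDriving_apply_eq_zero _ hκ0 hT'2)
    rw [mem_preimage, mem_singleton_iff, hZb] at hω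
    have h := congrArg (fun w : C(↥(Set.Icc (0:ℝ≥0) (T' + 2)), ℝ) ↦ w ⟨T' + 2, ⟨zero_le, le_rfl⟩⟩) hω
    simpa using h
  /- ■ lattice side -/
  have key : ∀ᶠ δ in 𝓝[>] (0:ℝ), P δ {ω | ∃ s u t : I, s < u ∧ u < t ∧ ℓ ≤ dist (X δ ω s) (X δ ω u) ∧
      dist (X δ ω s) (X δ ω t) ≤ ε} ≤ ENNReal.ofReal η := by
    filter_upwards [H3, e1, e2, e3, e4, p1w1, p1w2, p1w3, p1w4, p1w5, p1w6, p1w7] with δ h3 e1 e2 e3 e4 w1 w2 w3 w4 w5 w6 w7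
    set W1 : Set (Ω δ) := {ω | ∃ s t : unitInterval, s < t ∧ ℓ / 2 ≤ dist (X δ ω s) (D.pt 0) ∧ dist (X δ ω t) (D.pt 0) ≤ ra} with hW1def
    set W2 : Set (Ω δ) := {ω | ∃ s t : unitInterval, s < t ∧ dist (X δ ω s) (D.pt 1) ≤ rb ∧ ℓ / 2 ≤ dist (X δ ω t) (D.pt 1)} with hW2def
    set W3 : Set (Ω δ) := {ω | ∃ s t : unitInterval, s < t ∧ ra / 4 ≤ dist (X δ ω s) (D.pt 0) ∧ dist (X δ ω t) (D.pt 0) ≤ ra'} with hW3def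
    set W4 : Set (Ω δ) := {ω | ∃ s t : unitInterval, s < t ∧ dist (X δ ω s) (D.pt 1) ≤ rb' ∧ rb / 4 ≤ dist (X δ ω t) (D.pt 1)} with hW4def
    set W5 : Set (Ω δ) := {ω | ∃ s t : unitInterval, s < t ∧ dist (X δ ω s) (D.pt 1) ≤ rbW ∧ rbP ≤ dist (X δ ω t) (D.pt 1)} with hW5def
    set W6 : Set (Ω δ) := {ω | ∃ s t : unitInterval, s < t ∧ dist (X δ ω s) (D.pt 1) ≤ rb'' ∧ rbW ≤ dist (X δ ω t) (D.pt 1)} with hW6def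
    set W7 : Set (Ω δ) := {ω | ∃ s t : unitInterval, s < t ∧ raP ≤ dist (X δ ω s) (D.pt 0) ∧ dist (X δ ω t) (D.pt 0) ≤ ra''} with hW7def
    have hincl : {ω | ∃ s u t : I, s < u ∧ u < t ∧ ℓ ≤ dist (X δ ω s) (X δ ω u) ∧
        dist (X δ ω s) (X δ ω t) ≤ ε} ⊆
        ((Yf δ ⁻¹' closure A₀ ∪ Yf δ ⁻¹' {0}) ∪ (Yb δ ⁻¹' closure A₀' ∪ Yb δ ⁻¹' {0})) ∪
          (W1 ∪ W2 ∪ W3 ∪ W4 ∪ W5 ∪ W6 ∪ W7) := by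
      intro ω ⟨s, u, t, hsu, hut, hfar, hret⟩
      by_contra hno
      have hnA : Yf δ ω ∉ closure A₀ := fun h ↦ hno (Or.inl (Or.inl (Or.inl h)))
      have hn0 : Yf δ ω ∉ ({0} : Set _) := fun h ↦ hno (Or.inl (Or.inl (Or.inr h)))
      have hnA' : Yb δ ω ∉ closure A₀' := fun h ↦ hno (Or.inl (Or.inr (Or.inl h)))
      have hn0' : Yb δ ω ∉ ({0} : Set _) := fun h ↦ hno (Or.inl (Or.inr (Or.inr h)))
      have hW1 : ω ∉ W1 := fun h ↦ hno (Or.inr (Or.inl (Or.inl (Or.inl (Or.inl (Or.inl (Or.inl (h))))))))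
      have hW2 : ω ∉ W2 := fun h ↦ hno (Or.inr (Or.inl (Or.inl (Or.inl (Or.inl (Or.inl (Or.inr h)))))))
      have hW3 : ω ∉ W3 := fun h ↦ hno (Or.inr (Or.inl (Or.inl (Or.inl (Or.inl (Or.inr h))))))
      have hW4 : ω ∉ W4 := fun h ↦ hno (Or.inr (Or.inl (Or.inl (Or.inl (Or.inr h)))))
      have hW5 : ω ∉ W5 := fun h ↦ hno (Or.inr (Or.inl (Or.inl (Or.inr h))))
      have hW6 : ω ∉ W6 := fun h ↦ hno (Or.inr (Or.inl (Or.inr h)))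
      have hW7 : ω ∉ W7 := fun h ↦ hno (Or.inr (Or.inr h))
      obtain ⟨hXinj, hX0, hX1, hXint⟩ := h3 ω
      -- both drivers are honest
      have hdescF : IsLoewnerDescribable φ (CurveClass.mk (X δ ω)) := by
        by_contra h
        apply hn0
        rw [mem_singleton_iff, hYf]
        ext x
        rw [ContinuousMap.restrict_apply, ContinuousMap.coe_mk, drivingFunction_of_not h]
        rfl
      have hdescB : IsLoewnerDescribable φ' (CurveClass.mk (X δ ω).reverse) := by
        by_contra h
        apply hn0'
        rw [mem_singleton_iff, hYb]
        ext x
        rw [ContinuousMap.restrict_apply, ContinuousMap.coe_mk]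
        rw [show (CurveClass.mk (X δ ω)).reverse = CurveClass.mk (X δ ω).reverse from rfl,
          drivingFunction_of_not h]
        rfl
      -- good references off the bad driver sets
      obtain ⟨ρ, hgoodF⟩ : ∃ ρ : ℝ≥0 → ℂ, ((Continuous ρ ∧ (∀ u : NNReal, 0 ≤ (ρ u).im) ∧ ρ 0 = 0 ∧ (∀ t : NNReal, 0 < t → (t : ℝ) ≤ T + 1 → Metric.hausdorffDist (φ.boundaryExtension '' closure (Literature.Probability.RandomPlanarGeometry.Loewner.hull (drivingFunction φ (CurveClass.mk (X δ ω))) t)) ((fun u => φ.boundaryExtension (ρ u)) '' Set.Icc 0 t) ≤ ε) ∧ (∀ s t : NNReal, (s : ℝ) ≤ T + 1 → (t : ℝ) ≤ T + 1 → w ≤ |(s : ℝ) - t| → μ ≤ dist (φ.boundaryExtension (ρ s)) (φ.boundaryExtension (ρ t))) ∧ (∀ s t : NNReal, (s : ℝ) ≤ T + 1 → (t : ℝ) ≤ T + 1 → c₀ / 4 ≤ |(s : ℝ) - t| → μ₀ ≤ dist (φ.boundaryExtension (ρ s)) (φ.boundaryExtension (ρ t))) ∧ (∀ s s' : NNReal,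 (s : ℝ) ≤ T + 1 → (s' : ℝ) ≤ T + 1 → |(s : ℝ) - s'| ≤ θ + 4 * w → |(drivingFunction φ (CurveClass.mk (X δ ω))) s - (drivingFunction φ (CurveClass.mk (X δ ω))) s'| ≤ ρ₁) ∧ (∀ t₁ : NNReal, (t₁ : ℝ) ≤ T → ∃ u : NNReal, (t₁ : ℝ) + 2 * θ ≤ u ∧ (u : ℝ) ≤ t₁ + L * θ ∧ ρ u ∈ Literature.Probability.RandomPlanarGeometry.Loewner.domain (drivingFunction φ (CurveClass.mk (X δ ω))) t₁ ∧ m₁ ≤ ‖Literature.Probability.RandomPlanarGeometry.Loewner.map (drivingFunction φ (CurveClass.mk (X δ ω))) t₁ (ρ u) - (drivingFunction φ (CurveClass.mk (X δ ω))) t₁‖) ∧ (∀ t₁ : NNReal, (t₁ : ℝ) ≤ T → ∀ e ∈ D.carrier, d' ≤ Metric.infDist e ((fun u => φ.boundaryExtension (ρ u)) '' Set.Icc 0 (T + 1) ∪ frontier D.carrier) → φ.symm e ∈ Literature.Probability.RandomPlanarGeometry.Loewner.domain (drivingFunction φ (CurveClass.mk (X δ ω))) t₁ ∧ (h₀q /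 2) ≤ (Literature.Probability.RandomPlanarGeometry.Loewner.map (drivingFunction φ (CurveClass.mk (X δ ω))) t₁ (φ.symm e)).im) ∧ (∀ u : NNReal, α₀ / 2 ≤ (u : ℝ) → (u : ℝ) ≤ T + 1 → dB ≤ Metric.infDist (φ.boundaryExtension (ρ u)) (frontier D.carrier)) ∧ (∀ u : NNReal, (u : ℝ) ≤ T + 1 → (u : ℝ) < α₀ → dist (φ.boundaryExtension (ρ u)) (D.pt 0) < raP - ε)) ∧ ((∀ s t : NNReal, (s : ℝ) ≤ T + 1 → (t : ℝ) ≤ T + 1 → c₀ ≤ |(s : ℝ) - t| → μ₀ ≤ dist (φ.boundaryExtension (ρ s)) (φ.boundaryExtension (ρ t))) ∧ (∀ s t : NNReal, (s : ℝ) ≤ T + 1 → (t : ℝ) ≤ T + 1 → |(s : ℝ) - t| ≤ 2 * w → dist (φ.boundaryExtension (ρ s)) (φ.boundaryExtension (ρ t)) ≤ ν) ∧ (∀ s t : NNReal, (s : ℝ) ≤ T + 1 → (t : ℝ) ≤ T + 1 → |(s : ℝ) - t| < 9 * c₀ + w → dist (φ.boundaryExtension (ρ s)) (φ.boundaryExtension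 (ρ t)) < ℓ - 2 * ε) ∧ (∀ u' u : NNReal, u' ≤ u → (u : ℝ) ≤ T + 1 → raF - ε ≤ dist (φ.boundaryExtension (ρ u')) (D.pt 0) → raP + ε + 2 * dS ≤ dist (φ.boundaryExtension (ρ u)) (D.pt 0)) ∧ (∀ u : NNReal, (u : ℝ) ≤ T + 1 → (N : ℝ) < (u : ℝ) → dist (φ.boundaryExtension (ρ u)) (D.pt 1) < rbF - ε) ∧ (∀ u u' : NNReal, u ≤ u' → (u' : ℝ) ≤ T + 1 → rbF - ε ≤ dist (φ.boundaryExtension (ρ u')) (D.pt 1) → rbP + ε + 2 * dS ≤ dist (φ.boundaryExtension (ρ u)) (D.pt 1)) ∧ (dist (φ.boundaryExtension (ρ (T + 1))) (D.pt 1) + ε ≤ rbW) ∧ (∀ (y : ℂ) (u : NNReal), α₀ ≤ (u : ℝ) → (u : ℝ) ≤ (N : ℝ) + w → dist y (φ.boundaryExtension (ρ u)) ≤ ε → ∃ e ∈ D.carrier, dist e y ≤ 2 * dS ∧ d' ≤ Metric.infDist e ((fun u => φ.boundaryExtension (ρ u)) '' Set.Icc 0 (T + 1) ∪ frontier D.carrier))))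 := by
        by_contra hall
        refine hnA (subset_closure ?_)
        rw [hA₀, hYf]
        exact ⟨_, continuous_drivingFunction φ (CurveClass.mk (X δ ω)), rfl, fun ρ h ↦ hall ⟨ρ, h⟩⟩
      obtain ⟨ρ', hgoodB⟩ : ∃ ρ' : ℝ≥0 → ℂ, ((Continuous ρ' ∧ (∀ u : NNReal, 0 ≤ (ρ' u).im) ∧ ρ' 0 = 0 ∧ (∀ t : NNReal, 0 < t → (t : ℝ) ≤ T' + 1 → Metric.hausdorffDist (φ'.boundaryExtension '' closure (Literature.Probability.RandomPlanarGeometry.Loewner.hull (drivingFunction φ' ((CurveClass.mk (X δ ω)).reverse)) t)) ((fun u => φ'.boundaryExtension (ρ' u)) '' Set.Icc 0 t) ≤ ε') ∧ (∀ s t : NNReal, (s : ℝ) ≤ T' + 1 → (t : ℝ) ≤ T' + 1 → w' ≤ |(s : ℝ) - t| → μ' ≤ dist (φ'.boundaryExtension (ρ' s)) (φ'.boundaryExtension (ρ' t))) ∧ (∀ s t : NNReal, (s : ℝ) ≤ T' + 1 → (t : ℝ) ≤ T' + 1 → c₁ / 4 ≤ |(s : ℝ) - t| → μ₀' ≤ dist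 (φ'.boundaryExtension (ρ' s)) (φ'.boundaryExtension (ρ' t))) ∧ (∀ s s' : NNReal, (s : ℝ) ≤ T' + 1 → (s' : ℝ) ≤ T' + 1 → |(s : ℝ) - s'| ≤ θ' + 4 * w' → |(drivingFunction φ' ((CurveClass.mk (X δ ω)).reverse)) s - (drivingFunction φ' ((CurveClass.mk (X δ ω)).reverse)) s'| ≤ ρ₁') ∧ (∀ t₁ : NNReal, (t₁ : ℝ) ≤ T' → ∃ u : NNReal, (t₁ : ℝ) + 2 * θ' ≤ u ∧ (u : ℝ) ≤ t₁ + L' * θ' ∧ ρ' u ∈ Literature.Probability.RandomPlanarGeometry.Loewner.domain (drivingFunction φ' ((CurveClass.mk (X δ ω)).reverse)) t₁ ∧ m₁' ≤ ‖Literature.Probability.RandomPlanarGeometry.Loewner.map (drivingFunction φ' ((CurveClass.mk (X δ ω)).reverse)) t₁ (ρ' u) - (drivingFunction φ' ((CurveClass.mk (X δ ω)).reverse)) t₁‖) ∧ (∀ t₁ : NNReal, (t₁ : ℝ) ≤ T' → ∀ e ∈ D.swap.carrier, d'' ≤ Metric.infDist e ((fun u => φ'.boundaryExtension (ρ' u))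 '' Set.Icc 0 (T' + 1) ∪ frontier D.swap.carrier) → φ'.symm e ∈ Literature.Probability.RandomPlanarGeometry.Loewner.domain (drivingFunction φ' ((CurveClass.mk (X δ ω)).reverse)) t₁ ∧ (h₀q' / 2) ≤ (Literature.Probability.RandomPlanarGeometry.Loewner.map (drivingFunction φ' ((CurveClass.mk (X δ ω)).reverse)) t₁ (φ'.symm e)).im) ∧ (∀ u : NNReal, α₀' / 2 ≤ (u : ℝ) → (u : ℝ) ≤ T' + 1 → dB' ≤ Metric.infDist (φ'.boundaryExtension (ρ' u)) (frontier D.swap.carrier)) ∧ (∀ u : NNReal, (u : ℝ) ≤ T' + 1 → (u : ℝ) < α₀' → dist (φ'.boundaryExtension (ρ' u)) (D.swap.pt 0) < rbP - ε')) ∧ (∀ s t : NNReal, (s : ℝ) ≤ T' + 1 → (t : ℝ) ≤ T' + 1 → |(s : ℝ) - t| ≤ c₁ → dist (φ'.boundaryExtension (ρ' s)) (φ'.boundaryExtension (ρ' t)) < μ₀ / 2)) := by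
        by_contra hall
        refine hnA' (subset_closure ?_)
        rw [hA₀', hYb]
        exact ⟨_, continuous_drivingFunction φ' ((CurveClass.mk (X δ ω)).reverse), rfl, fun ρ h ↦ hall ⟨ρ, h⟩⟩
      -- the windows
      have nB1 : ∀ s t : I, s < t → ℓ / 2 ≤ dist (X δ ω s) (D.pt 0) → ra < dist (X δ ω t) (D.pt 0) :=
        fun s t hst h1 ↦ not_le.1 fun h2 ↦ hW1 ⟨s, t, hst, h1, h2⟩
      have nB2 : ∀ s t : I, s < t → dist (X δ ω s) (D.pt 1) ≤ rb → dist (X δ ω t) (D.pt 1) < ℓ / 2 :=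
        fun s t hst h1 ↦ not_le.1 fun h2 ↦ hW2 ⟨s, t, hst, h1, h2⟩
      have nB3 : ∀ s t : I, s < t → ra / 4 ≤ dist (X δ ω s) (D.pt 0) → ra' < dist (X δ ω t) (D.pt 0) :=
        fun s t hst h1 ↦ not_le.1 fun h2 ↦ hW3 ⟨s, t, hst, h1, h2⟩
      have nB4 : ∀ s t : I, s < t → dist (X δ ω s) (D.pt 1) ≤ rb' → dist (X δ ω t) (D.pt 1) < rb / 4 :=
        fun s t hst h1 ↦ not_le.1 fun h2 ↦ hW4 ⟨s, t, hst, h1, h2⟩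
      have nB5 : ∀ s t : I, s < t → raP ≤ dist (X δ ω s) (D.pt 0) → ra'' < dist (X δ ω t) (D.pt 0) :=
        fun s t hst h1 ↦ not_le.1 fun h2 ↦ hW7 ⟨s, t, hst, h1, h2⟩
      have nB6 : ∀ s t : I, s < t → dist (X δ ω s) (D.pt 1) ≤ rb'' → dist (X δ ω t) (D.pt 1) < rbW :=
        fun s t hst h1 ↦ not_le.1 fun h2 ↦ hW6 ⟨s, t, hst, h1, h2⟩
      have nB7 : ∀ s t : I, s < t → dist (X δ ω s) (D.pt 1) ≤ rbW → dist (X δ ω t) (D.pt 1) < rbP :=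
        fun s t hst h1 ↦ not_le.1 fun h2 ↦ hW5 ⟨s, t, hst, h1, h2⟩
      -- the capacity approach points
      have hapF := latF (drivingFunction φ (CurveClass.mk (X δ ω)))
        (Loewner.trace (drivingFunction φ (CurveClass.mk (X δ ω)))) (continuous_drivingFunction φ _)
        (isLoewnerDescribed_drivingFunction hdescF).exists_eq_mk_trace.1
      have hapB := latB (drivingFunction φ' (CurveClass.mk (X δ ω).reverse))
        (Loewner.trace (drivingFunction φ' (CurveClass.mk (X δ ω).reverse))) (continuous_drivingFunction φ' _)
        (isLoewnerDescribed_drivingFunction hdescB).exists_eq_mk_trace.1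
      rw [MarkedDomain.pt_swap_one] at hapB
      exact PathUpgradeRInst.inst D φ hφ φ' hφ' (X δ ω) hXinj hX0 hX1 hXint hdescF hdescB ρ ρ' T T'
        ε μ μ₀ μ₀ w c₀ ν θ ρ₁ m₁ (h₀q / 2) d' dS (μ₀ / 4) r₁ Rout α₀ dB (N : ℝ) raF raP rbF rbP rbW ℓ
        ε' μ' μ₀' w' c₁ θ' ρ₁' m₁' (h₀q' / 2) d'' (μ₀' / 4) r₁' Rout' α₀' dB' raP
        ra rb ra' rb' ra'' rb'' L L' hgoodF hgoodB hgate hgate' nB1 nB2 nB3 nB4 nB5 nB6 nB7 hapF hapB hnum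
        s u t hsu hut hfar hret
    have hWsum : (P δ W1 + P δ W2 + P δ W3 + P δ W4 + P δ W5 + P δ W6 + P δ W7) ≤ 7 * β := by
      have e : (7 : ℝ≥0∞) * β = β + β + β + β + β + β + β := by ring
      rw [e]
      exact add_le_add (add_le_add (add_le_add (add_le_add (add_le_add (add_le_add w1 w2) w3) w4) w5) w6) w7
    calc P δ {ω | ∃ s u t : I, s < u ∧ u < t ∧ ℓ ≤ dist (X δ ω s) (X δ ω u) ∧ dist (X δ ω s) (X δ ω t) ≤ ε}
        ≤ P δ (((Yf δ ⁻¹' closure A₀ ∪ Yf δ ⁻¹' {0}) ∪ (Yb δ ⁻¹' closure A₀' ∪ Yb δ ⁻¹' {0})) ∪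
            (W1 ∪ W2 ∪ W3 ∪ W4 ∪ W5 ∪ W6 ∪ W7)) := measure_mono hincl
      _ ≤ ((P δ (Yf δ ⁻¹' closure A₀) + P δ (Yf δ ⁻¹' {0})) +
            (P δ (Yb δ ⁻¹' closure A₀') + P δ (Yb δ ⁻¹' {0}))) + (P δ W1 + P δ W2 + P δ W3 + P δ W4 + P δ W5 + P δ W6 + P δ W7) := by
          refine (measure_union_le _ _).trans (add_le_add ((measure_union_le _ _).trans
            (add_le_add (measure_union_le _ _) (measure_union_le _ _))) ?_)
          exact (measure_union_le _ _).trans (add_le_add ((measure_union_le _ _).trans (add_le_add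
            ((measure_union_le _ _).trans (add_le_add ((measure_union_le _ _).trans (add_le_add
            ((measure_union_le _ _).trans (add_le_add ((measure_union_le _ _).trans (add_le_add le_rfl le_rfl))
            le_rfl)) le_rfl)) le_rfl)) le_rfl)) le_rfl)
      _ ≤ (((Process.preWienerMeasure (Zf ⁻¹' closure A₀) + β) + (Process.preWienerMeasure (Zf ⁻¹' {0}) + β)) +
            ((Process.preWienerMeasure (Zb ⁻¹' closure A₀') + β) +
              (Process.preWienerMeasure (Zb ⁻¹' {0}) + β))) + 7 * β :=
          add_le_add (add_le_add (add_le_add e1 e2) (add_le_add e3 e4)) hWsum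
      _ ≤ (((14 * β + β) + (0 + β)) + ((9 * β + β) + (0 + β))) + 7 * β := by
          gcongr
          · exact hSLE0f.le
          · exact hSLE0b.le
      _ = 34 * β := by ring
      _ ≤ 64 * β := by
          gcongr
          norm_num
      _ ≤ ENNReal.ofReal η := h64
  exact key

end Summit.CriticalPhenomena.SAWScalingLimit.Theorems

end
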